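import Summits.NavierStokesRegularity.NavierStokesRegularity.Theorems.ScenarioCensusRowF1ax
import Summits.NavierStokesRegularity.NavierStokesRegularity.Theorems.ScenarioCensusRowA7h
import Summits.NavierStokesRegularity.NavierStokesRegularity.Theorems.ScenarioCensusRowF1StretchedZoom
import Summits.NavierStokesRegularity.NavierStokesRegularity.Theorems.DssFarFieldSlavingBlowupTypeIDssProfileSimilarityEnstrophyBeltramiLiouville
import Summits.NavierStokesRegularity.NavierStokesRegularity.Theorems.SqueezeCycleSingularZoomWindow
import Summits.NavierStokesRegularity.NavierStokesRegularity.Theorems.ClockStretchingLawClockCeilingZoomDerivLimit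
import Summits.NavierStokesRegularity.NavierStokesRegularity.Theorems.PoloidalWindowDoorPoloidalWindowRigidityVorticityTranslate
import Summits.NavierStokesRegularity.NavierStokesRegularity.Theorems.HalfSpaceWindowDoorCirculationCarryingRigidityWholeSpaceMaxPrinciple
import Literature.Analysis.FluidPDE.TypeIAncientMild
import Literature.Analysis.FluidPDE.WholeSpaceIBP
import Literature.Analysis.FluidPDE.ClassicalSolutionCalculus
import Literature.Analysis.FluidPDE.VorticityEquation
import Literature.Analysis.FluidPDE.TypeIAncientMildClassical
import Summits.NavierStokesRegularity.NavierStokesRegularity.Theorems.DssFarFieldSlavingBlowupTypeIDssProfileSimilarityEnstrophyCrossFlowNoDecayOne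
import Summits.NavierStokesRegularity.NavierStokesRegularity.Theorems.DssFarFieldSlavingBlowupTypeIDssProfileSimilarityEnstrophyTimeOnlyThreshold
import HarnessLib
import Literature.Analysis.FluidPDE.TypeIAncientMildTimeAnalytic
import Literature.Analysis.Calculus.RealAnalyticZeroSetProofs
import Summits.NavierStokesRegularity.NavierStokesRegularity.Theorems.ScenarioCensusRowF1DenseLocus

/-!
# Census row F1, SPACE–TIME ANALYTIC RIGIDITY (thick cells F1βT / F1ωT / F1∣u∣T, dense F1∣u∣d; floors GTB / GVB / GFB / RFB) — LINE 32 «spacetime-locus» port, part 1/4: §8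
# SPACE–TIME RIGIDITY — vocabulary (density at a centre `DenseAt`, good times, thick near-locus `ThickNear`, `ThickLocusKills`, `ThickRow` / `ThickFloor` / `ThickSlack`),
# monotonicity in `ε` and persistent ⇒ thick, measurability of the good times.  §1–§7 of the line are LINES 27–31 VERBATIM and are taken BY NAME from the landed ports
# (`open …LiouvilleSocket …SharpTop …ThinTop …EventSocket …DenseLocus`; not re-declared)

Re-homed for the scenario census (typer seat ns-census-typer-1 g9; the thick cells F1βT / F1ωT / F1∣u∣T, the dense cell F1∣u∣d and the floors GTB / GVB / GFB / RFB are
MEMBERS OF RECORD «DECIDED IN KERNEL IN FILES» of row F1 since census v1.95 (critic idea-crit-3 g8 PASS 07:50:52Z — no price; ref ns-census-ref g12 PRE-CHECK ✓ §17.9 item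
63; lead-presearch label item 63); this port makes them TREE-decided): VERBATIM PORT of the NEW sections (§8–§10) of ns-idea-3 LINE 32 «spacetime-locus»,
`pub/ideators/ns-idea-3/lines/spacetime-locus/line-spacetime-locus.lean` sha16 a2ef5b2867fe7a2c (2078 l., lean check rc 0, 0 sorry; its §1–§7 = LINES 27–31 VERBATIM,
taken BY NAME from the landed liouville-socket / sharp-top / thin-top / event-socket / dense-locus ports), split for the 400-line rule into `ScenarioCensusRowF1SpacetimeLocus`
(§8 vocabulary) → `…SpacetimeLocusTransfer` (§8 transfer + engine) → `…SpacetimeLocusKill` (§9) → `…SpacetimeLocusRows` (§10 + census KEYS).  Lean text VERBATIM in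
namespace `…Theorems.ScenarioCensus.SpacetimeLocus` (the line's `…Cruxes.ScenarioCensusRowF1.SpacetimeLocusLine` re-homed) with the five predecessor namespaces opened; port
edits: the bracket lines `section Thick` / `end Thick` dropped and its `variable {F : Type*} [NormedAddCommGroup F]` repeated at the head of the two §8 parts, §8's VERBATIM
restatement of LINE 29's `volume_preimage_zoomTime` not re-declared (BY NAME), `@[conjecture]` on the residuals `BelThickSlack` / `CalmThickSlack` / `SlowThickSlack`
(≡ `ScenarioCensus.Row_F1`, OPEN), one-line docstrings added where missing (gate lint).  Statements untouched.

No census VALUE is moved here (row F1 stays OPEN-WITH-LINE; the members become TREE-decided by name); NS regularity is NOT proved; `Row_F1` is untouched (zero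
movement, `belThickSlack_iff_rowF1` / `calmThickSlack_iff_rowF1` / `slowThickSlack_iff_rowF1`); no summit statement is proved by this file. Lemmas that restate already-landed tree declarations are taken BY NAME (gate lint `dedup.landed`): `fderiv_smul_stPull_apply` = `InviscidTop.fderiv_smul_stPull_apply`, `fderiv_smul_stPull` = `InviscidTop.fderiv_smul_stPull`, `fderiv_fderiv_smul_stPull` = `InviscidTop.fderiv_fderiv_smul_stPull`, `tendsto_clm_of_tendsto_apply` = `InviscidTop.tendsto_clm_of_tendsto_apply`, `tendsto_fderiv_fderiv_apply_of_bound` = `InviscidTop.tendsto_fderiv_fderiv_apply_of_bound`, `tendsto_fderiv_fderiv_of_bound` = `InviscidTop.tendsto_fderiv_fderiv_of_bound`, `tendsto_fderiv_fderiv_of_typeI_seq_Ioo` = `InviscidTop.tendsto_fderiv_fderiv_of_typeI_seq_Ioo`, `fderiv3_smul_stPull` = `FrozenTop.fderiv3_smul_stPull`, `tendsto_fderiv3_of_typeI_seq_Ioo` = `FrozenTop.tendsto_fderiv3_of_typeI_seq_Ioo`, `tendsto_physicalTime` = `ColumnarTop.tendsto_physicalTime`, `eventually_fast` = `ColumnarTop.eventually_fast`,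 `sqrt_timeLag` = `StretchedTop.sqrt_timeLag`, `forall_of_forall_ne_zero` = `StretchedTop.forall_of_forall_ne_zero`, `radius_eq` = `FrozenTop.radius_eq`, `jointCond_everywhere₆` = `FrozenTop.jointCond_everywhere₄`, `continuousOn_quad` = `IntegratedStretch.continuousOn_quad`, `sqrt_nu_timeLag` = `IntegratedStretch.sqrt_nu_timeLag`, `sing_of_not_bounded` = `InviscidTop.sing_of_not_bounded`, `exists_singularZoom_package₃` = `FrozenTop.exists_singularZoom_package₃`, `lapD_eq_zero_of_eq_zero` = `FrozenTop.lapD_eq_zero_of_eq_zero`, `measurableSet_top` = `IntegratedStretch.measurableSet_top`.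
-/

-- the summit and its single problem share the name `NavierStokesRegularity` (D-0017 nested layout)
set_option linter.dupNamespace false

noncomputable section

open MeasureTheory Set Function Filter TopologicalSpace Metric
open scoped Topology NNReal ENNReal InnerProductSpace RealInnerProductSpace Laplacian

namespace Summit.NavierStokesRegularity.NavierStokesRegularity.Theorems.ScenarioCensus.SpacetimeLocus

open Literature.Analysis Literature.Analysis.FluidPDE
open Summit.NavierStokesRegularity.NavierStokesRegularity.Theorems
open Summit.NavierStokesRegularity.NavierStokesRegularity.Theorems.ScenarioCensus.LiouvilleSocket
open Summit.NavierStokesRegularity.NavierStokesRegularity.Theorems.ScenarioCensus.SharpTop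
open Summit.NavierStokesRegularity.NavierStokesRegularity.Theorems.ScenarioCensus.ThinTop
open Summit.NavierStokesRegularity.NavierStokesRegularity.Theorems.ScenarioCensus.EventSocket
open Summit.NavierStokesRegularity.NavierStokesRegularity.Theorems.ScenarioCensus.DenseLocus

variable {F : Type*} [NormedAddCommGroup F]

/-! ## §8 SPACE–TIME RIGIDITY (NEW IN THIS LINE): recurrent — scale-THICK in time — density of the near-locus
suffices, because `𝒦` is real-analytic JOINTLY in `(s, y)`; and the SPEED defect kills by analyticity ALONE -/

/-! ### Vocabulary: density at a centre, good times, thick near-locus -/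

/-- **Density of the `ε`-near-locus at the centre `x`** at time `t`: the points of the parabolic ball
`B(x, ρ√(ν(T−t)))` whose dimensionless jet is `ε`-close to `{q = 0}` fill at least the fraction `δ` of the ball. -/
def DenseAt (q : Jet → F) (ε δ ρ T ν : ℝ) (u : ℝ → E3 → E3) (t : ℝ) (x : E3) : Prop :=
  ENNReal.ofReal δ * volume (ball x (ρ * Real.sqrt (ν * (T - t)))) ≤
    volume (eventSlice (NearEv q ε) T ν u t ∩ ball x (ρ * Real.sqrt (ν * (T - t))))

/-- **GOOD TIMES**: the times `t ∈ (0, T)` at which EVERY parabolic ball is `δ`-filled by `ε`-near-locus points. -/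
def goodTimes (q : Jet → F) (ε δ ρ T ν : ℝ) (u : ℝ → E3 → E3) : Set ℝ :=
  {t | t ∈ Ioo 0 T ∧ ∀ x : E3, DenseAt q ε δ ρ T ν u t x}

/-- **SCALE-THICK NEAR-LOCUS** («`q`-THICK END»): for some `δ, ρ > 0`, some window shape `0 < a < b` and some
`η > 0`, for EVERY `ε > 0` the good times occupy measure `≥ η·l` of every late parabolic window `[T − l b, T − l a]`
(`l → 0⁺`).  This is RECURRENT density — a positive lower scale-density of good times — in place of the PERSISTENT
density `DenseNear` of LINE 31 (`thickNear_of_denseNear`: persistent ⇒ thick). -/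
def ThickNear (q : Jet → F) (T ν : ℝ) (u : ℝ → E3 → E3) : Prop :=
  ∃ δ : ℝ, 0 < δ ∧ ∃ ρ : ℝ, 0 < ρ ∧ ∃ a b η : ℝ, 0 < a ∧ a < b ∧ 0 < η ∧ ∀ ε : ℝ, 0 < ε →
    ∀ᶠ l in 𝓝[>] (0 : ℝ), ENNReal.ofReal (η * l) ≤ volume (goodTimes q ε δ ρ T ν u ∩ Icc (T - l * b) (T - l * a))

/-- **THE THICK KILL INTERFACE.**  A defect `q` THICK-KILLS if every field of `𝒦` whose exact locus has non-zero
measure on a NON-NULL SET OF SLICES `s < 0` (not on every slice) is trivial.  (Discharged below from `LocusKills`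
for analytic, scaling-homogeneous defects through the joint analyticity of `𝒦` in `(s, y)`.) -/
def ThickLocusKills (q : Jet → F) : Prop :=
  ∀ (M : ℝ) (W : ℝ → E3 → E3), IsTypeIAncientMild M W →
    volume {s : ℝ | s < 0 ∧ volume {y : E3 | q (ancientJet W s y) = 0} ≠ 0} ≠ 0 → ∀ s < (0 : ℝ), ∀ y : E3, W s y = 0

/-- **Generic row «`q`-THICK END»**: in the frame of `Row_F1`, a scale-thick near-locus implies smooth extension. -/
def ThickRow (q : Jet → F) : Prop :=
  ∀ (ν T : ℝ), 0 < ν → 0 < T → ∀ (u : ℝ → E3 → E3) (p : ℝ → E3 → ℝ),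
    IsClassicalNSSolutionOn (Ico 0 T) ν 0 u p → IsLerayHopfOn T ν 0 (u 0) u → HasRapidSpatialDecay (u 0) →
    IsTypeIBlowup u T → ThickNear q T ν u → HasSmoothExtensionPast ν 0 u T

/-- **Generic floor «SCALE-GENERIC `q`-FAR BALLS»**: a maximal Type-I blow-up is NOT `q`-thick at the end: for all
`δ, ρ > 0`, every window shape `0 < a < b` and every `η > 0` there is `ε > 0` such that along a sequence of scales
`l → 0⁺` the good times fill LESS than measure `η·l` of the window `[T − l b, T − l a]` (`not_thickNear_iff`). -/
def ThickFloor (q : Jet → F) : Prop :=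
  ∀ (ν T : ℝ), 0 < ν → 0 < T → ∀ (u : ℝ → E3 → E3) (p : ℝ → E3 → ℝ),
    IsMaximalSmoothSolution ν 0 u p T → IsLerayHopfOn T ν 0 (u 0) u → HasRapidSpatialDecay (u 0) →
    IsTypeIBlowup u T → ¬ ThickNear q T ν u

/-- **Generic residual «`q`-THICK SLACK»**: every maximal Type-I blow-up IS `q`-thick at the end — for a continuous
thick-killing defect EQUIVALENT to `Row_F1` (`thickSlack_iff_rowF1`); summit-hard, isolated, not claimed. -/
def ThickSlack (q : Jet → F) : Prop :=
  ∀ (ν T : ℝ), 0 < ν → 0 < T → ∀ (u : ℝ → E3 → E3) (p : ℝ → E3 → ℝ),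
    IsMaximalSmoothSolution ν 0 u p T → IsLerayHopfOn T ν 0 (u 0) u → HasRapidSpatialDecay (u 0) →
    IsTypeIBlowup u T → ThickNear q T ν u

/-- The thick floor, unfolded. -/
theorem not_thickNear_iff (q : Jet → F) (T ν : ℝ) (u : ℝ → E3 → E3) :
    ¬ ThickNear q T ν u ↔ ∀ δ : ℝ, 0 < δ → ∀ ρ : ℝ, 0 < ρ → ∀ a b η : ℝ, 0 < a → a < b → 0 < η → ∃ ε : ℝ, 0 < ε ∧
      ∃ᶠ l in 𝓝[>] (0 : ℝ),
        volume (goodTimes q ε δ ρ T ν u ∩ Icc (T - l * b) (T - l * a)) < ENNReal.ofReal (η * l) := by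
  simp only [ThickNear, not_exists, not_and, not_forall, not_eventually, not_le, exists_prop]

/-! ### Monotonicity in `ε` and the order lemma persistent ⇒ thick -/

/-- Density at a centre is monotone in `ε`. -/
theorem denseAt_mono (q : Jet → F) {ε₁ ε₂ : ℝ} (h : ε₁ ≤ ε₂) {δ ρ T ν : ℝ} {u : ℝ → E3 → E3} {t : ℝ} {x : E3}
    (hd : DenseAt q ε₁ δ ρ T ν u t x) : DenseAt q ε₂ δ ρ T ν u t x :=
  hd.trans (measure_mono (inter_subset_inter_left _ (eventSlice_mono (nearEv_mono q h) T ν u t)))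

/-- Good times are monotone in `ε`. -/
theorem goodTimes_mono (q : Jet → F) {ε₁ ε₂ : ℝ} (h : ε₁ ≤ ε₂) (δ ρ T ν : ℝ) (u : ℝ → E3 → E3) :
    goodTimes q ε₁ δ ρ T ν u ⊆ goodTimes q ε₂ δ ρ T ν u :=
  fun _ ht => ⟨ht.1, fun x => denseAt_mono q h (ht.2 x)⟩

/-- **Order lemma: PERSISTENT density (LINE 31's `DenseNear`) ⇒ THICK density** (window `[T − 2l, T − l]`, `η = 1`). -/
theorem thickNear_of_denseNear {q : Jet → F} {T ν : ℝ} (hT : 0 < T) {u : ℝ → E3 → E3}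
    (hD : DenseNear q T ν u) : ThickNear q T ν u := by
  obtain ⟨δ, hδ, ρ, hρ, hden⟩ := hD
  refine ⟨δ, hδ, ρ, hρ, 1, 2, 1, one_pos, by norm_num, one_pos, fun ε hε => ?_⟩
  obtain ⟨t₁, ht₁, hb⟩ := hden ε hε
  have hm : 0 < (T - max t₁ 0) / 2 := by
    have : max t₁ 0 < T := max_lt ht₁ hT
    linarith
  filter_upwards [Ioo_mem_nhdsGT hm] with l hl
  have hsub : Icc (T - l * 2) (T - l * 1) ⊆ goodTimes q ε δ ρ T ν u := by
    intro t ht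
    have h1 : max t₁ 0 < t := by linarith [hl.2, ht.1]
    have htT : t < T := by linarith [hl.1, ht.2]
    exact ⟨⟨lt_of_le_of_lt (le_max_right _ _) h1, htT⟩, fun x => hb t ⟨lt_of_le_of_lt (le_max_left _ _) h1, htT⟩ x⟩
  calc ENNReal.ofReal (1 * l) = volume (Icc (T - l * 2) (T - l * 1)) := by
        rw [Real.volume_Icc]; congr 1; ring
    _ ≤ volume (goodTimes q ε δ ρ T ν u ∩ Icc (T - l * 2) (T - l * 1)) :=
        measure_mono fun t ht => ⟨hsub ht, ht⟩

/-- **Order lemma on rows: the THICK row implies LINE 31's DENSE row** (a stronger theorem, weaker hypothesis). -/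
theorem locRow_of_thickRow {q : Jet → F} (h : ThickRow q) : LocRow q :=
  fun ν T hν hT u p hsol hLH hdec hTI hD => h ν T hν hT u p hsol hLH hdec hTI (thickNear_of_denseNear hT hD)

/-- **Order lemma on kills: a THICK kill is a kill.** -/
theorem locusKills_of_thickLocusKills {q : Jet → F} (hK : ThickLocusKills q) : LocusKills q := by
  intro M W hW hall
  refine hK M W hW fun h0 => ?_
  have hsub : Ioo (-1 : ℝ) 0 ⊆ {s : ℝ | s < 0 ∧ volume {y : E3 | q (ancientJet W s y) = 0} ≠ 0} :=
    fun s hs => ⟨hs.2, hall s hs.2⟩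
  have h1 : volume (Ioo (-1 : ℝ) 0) = 0 := measure_mono_null hsub h0
  rw [Real.volume_Ioo] at h1
  norm_num at h1

/-! ### Measurability of the good times (classical solutions): joint continuity of the physical jet on
`(0,T) × ℝ³`, Fubini measurability of slice volumes, and reduction to a dense sequence of centres -/

/-- The physical jet of a classical solution is JOINTLY continuous on `(0, T) × ℝ³` (the slice gradient is the
space–time gradient composed with the inclusion `y ↦ (0, y)`, on the open slab). -/
theorem continuousOn_physJet_uncurry {T ν : ℝ} {u : ℝ → E3 → E3} {p : ℝ → E3 → ℝ}
    (hsol : IsClassicalNSSolutionOn (Ico 0 T) ν 0 u p) :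
    ContinuousOn (fun z : ℝ × E3 => physJet T ν u z.1 z.2) (Ioo 0 T ×ˢ univ) := by
  have hO : IsOpen (Ioo 0 T ×ˢ (univ : Set E3)) := isOpen_Ioo.prod isOpen_univ
  have hsm := hsol.smooth_velocity.mono (Ioo_subset_Ico_self : Ioo 0 T ⊆ Ico 0 T)
  unfold IsSmoothSpaceTimeOn at hsm
  have hcu : ContinuousOn (uncurry u) (Ioo 0 T ×ˢ univ) := hsm.continuousOn
  have hcD : ContinuousOn (fun z => fderiv ℝ (uncurry u) z) (Ioo 0 T ×ˢ univ) :=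
    hsm.continuousOn_fderiv_of_isOpen hO (by simp)
  have hslice : ∀ z ∈ Ioo 0 T ×ˢ (univ : Set E3),
      fderiv ℝ (u z.1) z.2 = (fderiv ℝ (uncurry u) z).comp (ContinuousLinearMap.inr ℝ ℝ E3) := by
    rintro ⟨t, x⟩ hz
    have hd : DifferentiableAt ℝ (uncurry u) (t, x) :=
      (hsm.differentiableOn (by simp)).differentiableAt (hO.mem_nhds hz)
    have h2 : HasFDerivAt (fun y : E3 => ((t, y) : ℝ × E3)) (ContinuousLinearMap.inr ℝ ℝ E3) x :=
      hasFDerivAt_prodMk_right t x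
    exact (hd.hasFDerivAt.comp x h2).fderiv
  let Φ : ((ℝ × E3) →L[ℝ] E3) →L[ℝ] (E3 →L[ℝ] E3) :=
    (ContinuousLinearMap.compL ℝ E3 (ℝ × E3) E3).flip (ContinuousLinearMap.inr ℝ ℝ E3)
  have hc1 : ContinuousOn (fun z : ℝ × E3 => Real.sqrt ((T - z.1) / ν) • u z.1 z.2) (Ioo 0 T ×ˢ univ) :=
    ((Real.continuous_sqrt.comp (by fun_prop : Continuous fun z : ℝ × E3 => (T - z.1) / ν)).continuousOn).smul hcu
  have hc2' : ContinuousOn (fun z : ℝ × E3 => (T - z.1) • Φ (fderiv ℝ (uncurry u) z)) (Ioo 0 T ×ˢ univ) :=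
    ((by fun_prop : Continuous fun z : ℝ × E3 => T - z.1).continuousOn).smul (Φ.continuous.comp_continuousOn hcD)
  have hc2 : ContinuousOn (fun z : ℝ × E3 => (T - z.1) • fderiv ℝ (u z.1) z.2) (Ioo 0 T ×ˢ univ) := by
    refine hc2'.congr fun z hz => ?_
    simp only [hslice z hz, Φ, ContinuousLinearMap.flip_apply, ContinuousLinearMap.compL_apply]
  exact hc1.prodMk hc2

/-- The space–time near-locus set inside the moving parabolic ball at the centre `x` (open). -/
def nearBallST (q : Jet → F) (ε ρ T ν : ℝ) (u : ℝ → E3 → E3) (x : E3) : Set (ℝ × E3) :=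
  (Ioo 0 T ×ˢ univ ∩ (fun z : ℝ × E3 => physJet T ν u z.1 z.2) ⁻¹' NearEv q ε) ∩
    {z | dist z.2 x < ρ * Real.sqrt (ν * (T - z.1))}

/-- The space–time near-locus ball set is open. -/
theorem isOpen_nearBallST {q : Jet → F} (hq : Continuous q) (ε ρ : ℝ) {T ν : ℝ} {u : ℝ → E3 → E3}
    {p : ℝ → E3 → ℝ} (hsol : IsClassicalNSSolutionOn (Ico 0 T) ν 0 u p) (x : E3) :
    IsOpen (nearBallST q ε ρ T ν u x) := by
  refine IsOpen.inter ?_ ?_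
  · exact (continuousOn_physJet_uncurry hsol).isOpen_inter_preimage (isOpen_Ioo.prod isOpen_univ)
      (isOpen_nearEv hq ε)
  · exact isOpen_lt (by fun_prop) (continuous_const.mul (Real.continuous_sqrt.comp (by fun_prop)))

/-- The time slices of `nearBallST` are the near-locus slices cut by the parabolic ball. -/
theorem prodMk_preimage_nearBallST (q : Jet → F) (ε ρ : ℝ) {T ν : ℝ} (u : ℝ → E3 → E3) (x : E3) {t : ℝ}
    (ht : t ∈ Ioo 0 T) :
    Prod.mk t ⁻¹' nearBallST q ε ρ T ν u x =
      eventSlice (NearEv q ε) T ν u t ∩ ball x (ρ * Real.sqrt (ν * (T - t))) := by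
  ext y
  simp only [nearBallST, mem_preimage, mem_inter_iff, mem_prod, ht, mem_univ, and_self, true_and, mem_setOf_eq,
    eventSlice, mem_ball]

/-- The set of good times AT ONE CENTRE is measurable (Fubini measurability of slice volumes of an open set;
monotonicity of `r ↦ vol B(x, r)`). -/
theorem measurableSet_goodAt {q : Jet → F} (hq : Continuous q) (ε δ ρ : ℝ) {T ν : ℝ} {u : ℝ → E3 → E3}
    {p : ℝ → E3 → ℝ} (hsol : IsClassicalNSSolutionOn (Ico 0 T) ν 0 u p) (x : E3) :
    MeasurableSet {t : ℝ | t ∈ Ioo 0 T ∧ DenseAt q ε δ ρ T ν u t x} := by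
  have hg : Measurable fun t : ℝ => volume (Prod.mk t ⁻¹' nearBallST q ε ρ T ν u x) :=
    measurable_measure_prodMk_left (isOpen_nearBallST hq ε ρ hsol x).measurableSet
  have hr : Measurable fun t : ℝ => ρ * Real.sqrt (ν * (T - t)) :=
    (continuous_const.mul (Real.continuous_sqrt.comp (by fun_prop))).measurable
  have hmono : Monotone fun r : ℝ => volume (ball x r) := fun r₁ r₂ h => measure_mono (ball_subset_ball h)
  have hf : Measurable fun t : ℝ => ENNReal.ofReal δ * volume (ball x (ρ * Real.sqrt (ν * (T - t)))) :=
    (hmono.measurable.comp hr).const_mul _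
  have e : {t : ℝ | t ∈ Ioo 0 T ∧ DenseAt q ε δ ρ T ν u t x} = Ioo 0 T ∩
      {t | ENNReal.ofReal δ * volume (ball x (ρ * Real.sqrt (ν * (T - t)))) ≤
        volume (Prod.mk t ⁻¹' nearBallST q ε ρ T ν u x)} := by
    ext t
    simp only [mem_setOf_eq, mem_inter_iff]
    constructor
    · rintro ⟨ht, hd⟩
      refine ⟨ht, ?_⟩
      rw [prodMk_preimage_nearBallST q ε ρ u x ht]
      exact hd
    · rintro ⟨ht, hd⟩
      refine ⟨ht, ?_⟩
      rw [prodMk_preimage_nearBallST q ε ρ u x ht] at hd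
      exact hd
  rw [e]
  exact measurableSet_Ioo.inter (measurableSet_le hf hg)

/-- **Reduction to a dense sequence of centres.**  At a fixed time, density at the centres of a dense sequence gives
density at EVERY centre (nearby balls are nested up to a thin shell; continuity of measure from above; spheres are
null). -/
theorem denseAt_of_denseSeq {q : Jet → F} (hq : Continuous q) {ε δ ρ T ν : ℝ}
    {u : ℝ → E3 → E3} {p : ℝ → E3 → ℝ} (hsol : IsClassicalNSSolutionOn (Ico 0 T) ν 0 u p) {t : ℝ}
    (ht : t ∈ Ioo 0 T) (h : ∀ n : ℕ, DenseAt q ε δ ρ T ν u t (denseSeq E3 n)) (x : E3) :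
    DenseAt q ε δ ρ T ν u t x := by
  unfold DenseAt at h ⊢
  set r := ρ * Real.sqrt (ν * (T - t)) with hr
  set O := eventSlice (NearEv q ε) T ν u t with hO
  have hOm : MeasurableSet O := (isOpen_eventSlice (isOpen_nearEv hq ε) hsol ⟨ht.1.le, ht.2⟩).measurableSet
  have hd := denseRange_denseSeq E3
  have hstep : ∀ m : ℕ, ENNReal.ofReal δ * volume (ball x r) ≤ volume (O ∩ ball x (r + 1 / ((m : ℝ) + 1))) := by
    intro m
    obtain ⟨n, hn⟩ := hd.exists_dist_lt x (show (0 : ℝ) < 1 / ((m : ℝ) + 1) by positivity)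
    have hball : ball (denseSeq E3 n) r ⊆ ball x (r + 1 / ((m : ℝ) + 1)) :=
      ball_subset_ball' (by linarith [dist_comm (denseSeq E3 n) x])
    have hvb : volume (ball x r) = volume (ball (denseSeq E3 n) r) := by
      rw [EuclideanSpace.volume_ball, EuclideanSpace.volume_ball]
    calc ENNReal.ofReal δ * volume (ball x r) = ENNReal.ofReal δ * volume (ball (denseSeq E3 n) r) := by rw [hvb]
      _ ≤ volume (O ∩ ball (denseSeq E3 n) r) := h n
      _ ≤ volume (O ∩ ball x (r + 1 / ((m : ℝ) + 1))) := measure_mono (inter_subset_inter_right _ hball)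
  have hanti : Antitone fun m : ℕ => O ∩ ball x (r + 1 / ((m : ℝ) + 1)) := by
    intro m m' hmm'
    refine inter_subset_inter_right _ (ball_subset_ball ?_)
    have h1 : (m : ℝ) + 1 ≤ (m' : ℝ) + 1 := by
      have : (m : ℝ) ≤ m' := by exact_mod_cast hmm'
      linarith
    have := one_div_le_one_div_of_le (by positivity : (0 : ℝ) < (m : ℝ) + 1) h1
    linarith
  have hmeas : ∀ m : ℕ, NullMeasurableSet (O ∩ ball x (r + 1 / ((m : ℝ) + 1))) volume :=
    fun m => (hOm.inter measurableSet_ball).nullMeasurableSet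
  have hfin : ∃ m : ℕ, volume (O ∩ ball x (r + 1 / ((m : ℝ) + 1))) ≠ ⊤ :=
    ⟨0, ((measure_mono inter_subset_right).trans_lt measure_ball_lt_top).ne⟩
  have hle : ENNReal.ofReal δ * volume (ball x r) ≤ volume (⋂ m : ℕ, O ∩ ball x (r + 1 / ((m : ℝ) + 1))) :=
    ge_of_tendsto (tendsto_measure_iInter_atTop hmeas hanti hfin) (Eventually.of_forall hstep)
  have hsub : (⋂ m : ℕ, O ∩ ball x (r + 1 / ((m : ℝ) + 1))) ⊆ (O ∩ ball x r) ∪ sphere x r := by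
    intro y hy
    have hyO : y ∈ O := (mem_iInter.1 hy 0).1
    have hdist : dist y x ≤ r := by
      by_contra hlt
      push Not at hlt
      obtain ⟨m, hm⟩ := exists_nat_one_div_lt (by linarith : 0 < dist y x - r)
      have hym := (mem_iInter.1 hy m).2
      rw [mem_ball] at hym
      linarith
    rcases hdist.lt_or_eq with hlt | heq
    · exact Or.inl ⟨hyO, mem_ball.2 hlt⟩
    · exact Or.inr (mem_sphere.2 heq)
  calc ENNReal.ofReal δ * volume (ball x r) ≤ volume ((O ∩ ball x r) ∪ sphere x r) := hle.trans (measure_mono hsub)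
    _ ≤ volume (O ∩ ball x r) + volume (sphere x r) := measure_union_le _ _
    _ = volume (O ∩ ball x r) := by rw [Measure.addHaar_sphere, add_zero]

/-- The good times are the good times of a dense SEQUENCE of centres. -/
theorem goodTimes_eq_iInter {q : Jet → F} (hq : Continuous q) {ε δ ρ T ν : ℝ}
    {u : ℝ → E3 → E3} {p : ℝ → E3 → ℝ} (hsol : IsClassicalNSSolutionOn (Ico 0 T) ν 0 u p) :
    goodTimes q ε δ ρ T ν u = ⋂ n : ℕ, {t : ℝ | t ∈ Ioo 0 T ∧ DenseAt q ε δ ρ T ν u t (denseSeq E3 n)} := by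
  ext t
  simp only [goodTimes, mem_setOf_eq, mem_iInter]
  constructor
  · exact fun h n => ⟨h.1, h.2 _⟩
  · intro h
    exact ⟨(h 0).1, denseAt_of_denseSeq hq hsol (h 0).1 (fun n => (h n).2)⟩

/-- **The good times of a classical solution are measurable.** -/
theorem measurableSet_goodTimes {q : Jet → F} (hq : Continuous q) (ε δ ρ : ℝ) {T ν : ℝ}
    {u : ℝ → E3 → E3} {p : ℝ → E3 → ℝ} (hsol : IsClassicalNSSolutionOn (Ico 0 T) ν 0 u p) :
    MeasurableSet (goodTimes q ε δ ρ T ν u) := by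
  rw [goodTimes_eq_iInter hq hsol]
  exact MeasurableSet.iInter fun n => measurableSet_goodAt hq ε δ ρ hsol _

end Summit.NavierStokesRegularity.NavierStokesRegularity.Theorems.ScenarioCensus.SpacetimeLocus

end
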